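import Mathlib
import HarnessLib

/-!
# Venture HSemireg — th-3's defect formula as a ring identity

HONEST FRAMING. Lean leaf for the computation cell `pub-hsemireg` (target seat t-5 gen 21; files of record
`run/shared/lean/pub/pub-hsemireg/theory/TH3-SIGMA-ORBIT-PROOF.md` §7.2 (th-3 gen 28, the formula) and
`run/shared/lean/pub/pub-hsemireg/target-g6/OMEGA-LAW-t5g21.md` §1 (t-5 gen 21, its use)). In the minimal model of a
«reduced-point complex» a class has even components `B₀ B₁ B₂` and odd potentials `W₀ W₁ W₂` tied to the three odd
gluing operators `u₀ u₁ u₂` by the nine Killing relations (E1) `u_l W_j + W_j u_l = ε_{jli} B_i`, i.e.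
`{u_l,W_l} = 0`, `{u₀,W₁} = -B₂`, `{u₀,W₂} = B₁`, `{u₁,W₂} = -B₀`, `{u₁,W₀} = B₂`, `{u₂,W₀} = -B₁`, `{u₂,W₁} = B₀`.
The DEFECTS are `D_{li} := u_l B_i - B_i u_l` and the CURVATURES `S_{ab} := u_a u_b + u_b u_a`. th-3's DEFECT FORMULA
(TH3-SIGMA-ORBIT-PROOF §7.2, char ∉ {2,3}) says: for every (E1)-class,
`3·D_{li} - δ_{li}·(D₀₀ + D₁₁ + D₂₂) = [S_{l,i-1}, W_{i+1}] - [S_{l,i+1}, W_{i-1}]`, so that the closedness relation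
(E2) `D₀₀ + D₁₁ + D₂₂ = 0` is equivalent to «every defect is the pure curvature term». THIS FILE kernel-checks the
three identities of the row `l = 0` in an arbitrary ring (the rows `l = 1, 2` follow by the cyclic relabelling
`0 → 1 → 2 → 0` of all indices); each needs only three or four of the nine Killing relations. These are the «step 2» of
the reduction `str T = Ω₁` of OMEGA-LAW-t5g21 §1; nothing here concerns (E2), the law (Ω)₄, or (W³); no object is
constructed; nothing here bears on HC, HC_CM or HC_AV.
-/

namespace Summit.Ventures.HSemireg

/-- **Defect formula, off-diagonal component `(l,i) = (0,1)`** (th-3, TH3-SIGMA-ORBIT-PROOF §7.2; any ring).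
From the Killing relations `{u₀,W₀} = 0`, `{u₀,W₂} = B₁`, `{u₂,W₀} = -B₁`:
`3·[u₀,B₁] = [S₀₀, W₂] - [S₀₂, W₀]` with `S₀₀ = u₀u₀ + u₀u₀`, `S₀₂ = u₀u₂ + u₂u₀`.
Certificate: `LHS - RHS = -2·[u₀, {u₀,W₂} - B₁] + [u₀, {u₂,W₀} + B₁] + [u₂, {u₀,W₀}]`. [folklore] -/
theorem defectFormula_row0_col1 {R : Type*} [Ring R] (u₀ u₂ B₁ W₀ W₂ : R)
    (h00 : u₀ * W₀ + W₀ * u₀ = 0) (h02 : u₀ * W₂ + W₂ * u₀ = B₁) (h20 : u₂ * W₀ + W₀ * u₂ = -B₁) :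
    3 * (u₀ * B₁ - B₁ * u₀)
      = ((u₀ * u₀ + u₀ * u₀) * W₂ - W₂ * (u₀ * u₀ + u₀ * u₀))
        - ((u₀ * u₂ + u₂ * u₀) * W₀ - W₀ * (u₀ * u₂ + u₂ * u₀)) := by
  have e02 : u₀ * W₂ + W₂ * u₀ - B₁ = 0 := by rw [h02, sub_self]
  have e20 : u₂ * W₀ + W₀ * u₂ + B₁ = 0 := by rw [h20, neg_add_cancel]
  have key : 3 * (u₀ * B₁ - B₁ * u₀)
      - (((u₀ * u₀ + u₀ * u₀) * W₂ - W₂ * (u₀ * u₀ + u₀ * u₀))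
        - ((u₀ * u₂ + u₂ * u₀) * W₀ - W₀ * (u₀ * u₂ + u₂ * u₀)))
      = -2 * (u₀ * (u₀ * W₂ + W₂ * u₀ - B₁) - (u₀ * W₂ + W₂ * u₀ - B₁) * u₀)
        + (u₀ * (u₂ * W₀ + W₀ * u₂ + B₁) - (u₂ * W₀ + W₀ * u₂ + B₁) * u₀)
        + (u₂ * (u₀ * W₀ + W₀ * u₀) - (u₀ * W₀ + W₀ * u₀) * u₂) := by
    noncomm_ring
  rw [e02, e20, h00] at key
  have : 3 * (u₀ * B₁ - B₁ * u₀)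
      - (((u₀ * u₀ + u₀ * u₀) * W₂ - W₂ * (u₀ * u₀ + u₀ * u₀))
        - ((u₀ * u₂ + u₂ * u₀) * W₀ - W₀ * (u₀ * u₂ + u₂ * u₀))) = 0 := by
    rw [key]; noncomm_ring
  exact sub_eq_zero.mp this

/-- **Defect formula, off-diagonal component `(l,i) = (0,2)`** (th-3, TH3-SIGMA-ORBIT-PROOF §7.2; any ring).
From the Killing relations `{u₀,W₀} = 0`, `{u₀,W₁} = -B₂`, `{u₁,W₀} = B₂`:
`3·[u₀,B₂] = [S₀₁, W₀] - [S₀₀, W₁]` with `S₀₁ = u₀u₁ + u₁u₀`, `S₀₀ = u₀u₀ + u₀u₀`.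
Certificate: `LHS - RHS = 2·[u₀, {u₀,W₁} + B₂] - [u₀, {u₁,W₀} - B₂] - [u₁, {u₀,W₀}]`. [folklore] -/
theorem defectFormula_row0_col2 {R : Type*} [Ring R] (u₀ u₁ B₂ W₀ W₁ : R)
    (h00 : u₀ * W₀ + W₀ * u₀ = 0) (h01 : u₀ * W₁ + W₁ * u₀ = -B₂) (h10 : u₁ * W₀ + W₀ * u₁ = B₂) :
    3 * (u₀ * B₂ - B₂ * u₀)
      = ((u₀ * u₁ + u₁ * u₀) * W₀ - W₀ * (u₀ * u₁ + u₁ * u₀))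
        - ((u₀ * u₀ + u₀ * u₀) * W₁ - W₁ * (u₀ * u₀ + u₀ * u₀)) := by
  have e01 : u₀ * W₁ + W₁ * u₀ + B₂ = 0 := by rw [h01, neg_add_cancel]
  have e10 : u₁ * W₀ + W₀ * u₁ - B₂ = 0 := by rw [h10, sub_self]
  have key : 3 * (u₀ * B₂ - B₂ * u₀)
      - (((u₀ * u₁ + u₁ * u₀) * W₀ - W₀ * (u₀ * u₁ + u₁ * u₀))
        - ((u₀ * u₀ + u₀ * u₀) * W₁ - W₁ * (u₀ * u₀ + u₀ * u₀)))
      = 2 * (u₀ * (u₀ * W₁ + W₁ * u₀ + B₂) - (u₀ * W₁ + W₁ * u₀ + B₂) * u₀)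
        - (u₀ * (u₁ * W₀ + W₀ * u₁ - B₂) - (u₁ * W₀ + W₀ * u₁ - B₂) * u₀)
        - (u₁ * (u₀ * W₀ + W₀ * u₀) - (u₀ * W₀ + W₀ * u₀) * u₁) := by
    noncomm_ring
  rw [e01, e10, h00] at key
  have : 3 * (u₀ * B₂ - B₂ * u₀)
      - (((u₀ * u₁ + u₁ * u₀) * W₀ - W₀ * (u₀ * u₁ + u₁ * u₀))
        - ((u₀ * u₀ + u₀ * u₀) * W₁ - W₁ * (u₀ * u₀ + u₀ * u₀))) = 0 := by
    rw [key]; noncomm_ring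
  exact sub_eq_zero.mp this

/-- **Defect formula, diagonal component `(l,i) = (0,0)`** (th-3, TH3-SIGMA-ORBIT-PROOF §7.2; any ring).
From the Killing relations `{u₀,W₁} = -B₂`, `{u₀,W₂} = B₁`, `{u₁,W₂} = -B₀`, `{u₂,W₁} = B₀`:
`3·[u₀,B₀] - ([u₀,B₀] + [u₁,B₁] + [u₂,B₂]) = [S₀₂, W₁] - [S₀₁, W₂]`, i.e. the diagonal defect equals the pure
curvature term up to one third of the «divergence» `Σ_k [u_k,B_k]` — which is exactly what the closedness relation (E2)
kills. Certificate: `LHS - RHS = -[u₀,{u₂,W₁} - B₀] - [u₂,{u₀,W₁} + B₂] + [u₀,{u₁,W₂} + B₀] + [u₁,{u₀,W₂} - B₁]`.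
[folklore] -/
theorem defectFormula_row0_col0 {R : Type*} [Ring R] (u₀ u₁ u₂ B₀ B₁ B₂ W₁ W₂ : R)
    (h01 : u₀ * W₁ + W₁ * u₀ = -B₂) (h02 : u₀ * W₂ + W₂ * u₀ = B₁)
    (h12 : u₁ * W₂ + W₂ * u₁ = -B₀) (h21 : u₂ * W₁ + W₁ * u₂ = B₀) :
    3 * (u₀ * B₀ - B₀ * u₀) - ((u₀ * B₀ - B₀ * u₀) + (u₁ * B₁ - B₁ * u₁) + (u₂ * B₂ - B₂ * u₂))
      = ((u₀ * u₂ + u₂ * u₀) * W₁ - W₁ * (u₀ * u₂ + u₂ * u₀))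
        - ((u₀ * u₁ + u₁ * u₀) * W₂ - W₂ * (u₀ * u₁ + u₁ * u₀)) := by
  have e01 : u₀ * W₁ + W₁ * u₀ + B₂ = 0 := by rw [h01, neg_add_cancel]
  have e02 : u₀ * W₂ + W₂ * u₀ - B₁ = 0 := by rw [h02, sub_self]
  have e12 : u₁ * W₂ + W₂ * u₁ + B₀ = 0 := by rw [h12, neg_add_cancel]
  have e21 : u₂ * W₁ + W₁ * u₂ - B₀ = 0 := by rw [h21, sub_self]
  have key : (3 * (u₀ * B₀ - B₀ * u₀) - ((u₀ * B₀ - B₀ * u₀) + (u₁ * B₁ - B₁ * u₁) + (u₂ * B₂ - B₂ * u₂)))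
      - (((u₀ * u₂ + u₂ * u₀) * W₁ - W₁ * (u₀ * u₂ + u₂ * u₀))
        - ((u₀ * u₁ + u₁ * u₀) * W₂ - W₂ * (u₀ * u₁ + u₁ * u₀)))
      = -(u₀ * (u₂ * W₁ + W₁ * u₂ - B₀) - (u₂ * W₁ + W₁ * u₂ - B₀) * u₀)
        - (u₂ * (u₀ * W₁ + W₁ * u₀ + B₂) - (u₀ * W₁ + W₁ * u₀ + B₂) * u₂)
        + (u₀ * (u₁ * W₂ + W₂ * u₁ + B₀) - (u₁ * W₂ + W₂ * u₁ + B₀) * u₀)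
        + (u₁ * (u₀ * W₂ + W₂ * u₀ - B₁) - (u₀ * W₂ + W₂ * u₀ - B₁) * u₁) := by
    noncomm_ring
  rw [e01, e02, e12, e21] at key
  have : (3 * (u₀ * B₀ - B₀ * u₀) - ((u₀ * B₀ - B₀ * u₀) + (u₁ * B₁ - B₁ * u₁) + (u₂ * B₂ - B₂ * u₂)))
      - (((u₀ * u₂ + u₂ * u₀) * W₁ - W₁ * (u₀ * u₂ + u₂ * u₀))
        - ((u₀ * u₁ + u₁ * u₀) * W₂ - W₂ * (u₀ * u₁ + u₁ * u₀))) = 0 := by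
    rw [key]; noncomm_ring
  exact sub_eq_zero.mp this

end Summit.Ventures.HSemireg
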